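import Mathlib
import HarnessLib
import Literature.Combinatorics.Additive.QuasiProgressions
import Literature.Combinatorics.Additive.KempermanElementaryPairs

/-!
# Grynkiewicz 2009, §6 Claim 9: the progression / coset exclusions for `A = {0, d, x}`

[cite: Grynkiewicz2009, §6 Claim 9 (proof of Thm 4.1, pp. 27–29)] [tag: critical-pair] [tag: inverse-theorem]

Topic `Literature/Combinatorics/Additive`.  Cell `mm-stpp` (D-0046), seat `mm-stpp-lit` (gen 24); the
port of D. J. Grynkiewicz, *A step beyond Kemperman's structure theorem*, Mathematika **55** (2009)
67–114 continued.  In §6 Claim 9 (`|A| = 3`, print pp. 28–29) the terminal computation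
(`Grynkiewicz2009.claim9_terminal`, `StepBeyondKempermanThreeFour.lean`) is fed by a list of
exclusions which the print obtains in two sentences: «Since `d⊆(A, AP) ≥ 2` (eq. (51)), then it follows
that `x ∉ {2d, 3d, −d, −2d}`, `d ∉ {2x, 3x, −x, −2x}` and `0 ∉ {2x − d, 3x − 2d, 2d − x, 3d − 2x}`.
Additionally, `A` not quasi-periodic (Claim 4) with `|A| = 3` implies `A` does not contain a coset of an
order two subgroup» (p. 29; and p. 27 for `|A| = |B| = 3`: «no two elements from `A` can form a coset of
an order two subgroup»), plus the two exclusions `3d ≠ 0`, `2x + d ≠ 0` that `claim9_terminal` documents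
as coming from (47) resp. (51).  This file DERIVES that list, for `A = {0, d, x}` with `|A| = 3`, from the
standing assumptions in the tree's vocabulary: `2 ≤ d⊆(A, 𝒬𝒫)` (display (47)) and
`2 ≤ d⊆(A, 𝒬𝒜𝒫_e)` for every `e ≠ 0` (display (50), the tree's form of (51)).

HOW.  Each progression exclusion says that `A` lies, up to at most one hole, in a 3- or 4-term
progression `P` with difference `e ≠ 0`; either the terms of `P` extended by one stay distinct — then `P`
is a quasi-progression (`isQuasiProgression_apFinset`) and `d⊆(A, 𝒬𝒜𝒫_e) ≤ 1` — or a multiple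
`k e = 0` with `k ≤ |P|` makes `P` a full `⟨e⟩`-coset, hence periodic and quasi-periodic, and
`d⊆(A, 𝒬𝒫) ≤ 1` (`subsetDist_le_one_of_subset_apFinset`).  A two-element coset of an order-two subgroup
inside `A` makes `A` itself quasi-periodic (`isQuasiPeriodic_of_pair`), and `3d = 0` puts `A` with one
hole inside `⟨d⟩ ∪ {x}` (`subsetDist_le_one_of_three_nsmul`).

MAIN STATEMENT: `claim9_exclusions` — exactly the thirteen side conditions of `claim9_terminal`
(`d ≠ 0`, `x ≠ 0`, `x ≠ d`, `2d ≠ 0`, `2x ≠ 0`, `2(x − d) ≠ 0`, `x ≠ 2d`, `x ≠ 3d`, `x ≠ −d`, `x ≠ −2d`,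
`d ≠ 2x`, `3d ≠ 0`, `3d − 2x ≠ 0`, `2x + d ≠ 0`).  No new definitions, no named facts.

## References
* D. J. Grynkiewicz, *A step beyond Kemperman's structure theorem*, Mathematika 55 (2009) 67–114,
  doi:10.1112/S0025579300000966; §6 Claim 9 (pp. 28–29), Claim 6 (p. 27), displays (47), (50), (51)
  (held `paper:doi-10-1112-s0025579300000966`, pp. 27–29 read 2026-08-29) [cite: Grynkiewicz2009, §6 Claim 9].
-/

namespace Literature.Combinatorics.Additive.Grynkiewicz2009

open Finset
open scoped Pointwise

variable {G : Type*} [AddCommGroup G] [DecidableEq G]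

/-! ### Progressions with a small vanishing multiple are cosets -/

/-- If `k e = 0` with `1 ≤ k ≤ n`, the progression `{s, s + e, …, s + (n−1)e}` is invariant under
translation by `e` (it is the full coset `s + ⟨e⟩`). [cite: Grynkiewicz2009, §2 (progressions, «for
`l < ⟨d⟩`»)] -/
theorem vadd_apFinset_eq_of_nsmul_eq_zero {s e : G} {k n : ℕ} (hk : 1 ≤ k) (hkn : k ≤ n)
    (h : k • e = 0) : e +ᵥ apFinset s e n = apFinset s e n := by
  refine eq_of_subset_of_card_le (fun y hy => ?_) (by rw [card_vadd_finset])
  obtain ⟨z, hz, rfl⟩ := mem_vadd_finset.1 hy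
  obtain ⟨i, hi, rfl⟩ := mem_apFinset.1 hz
  rw [vadd_eq_add, mem_apFinset]
  by_cases hi1 : i + 1 < n
  · exact ⟨i + 1, hi1, by rw [succ_nsmul]; abel⟩
  · refine ⟨i + 1 - k, by omega, ?_⟩
    have : (i + 1 - k) • e = (i + 1) • e := by
      conv_rhs => rw [show i + 1 = (i + 1 - k) + k by omega, add_nsmul, h, add_zero]
    rw [this, succ_nsmul]
    abel

/-- If no multiple `k e`, `1 ≤ k ≤ n`, vanishes, the `n + 1` terms `s, s + e, …, s + n e` are distinct.
[cite: Grynkiewicz2009, §2 (progressions)] -/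
theorem card_apFinset_succ_of_forall_nsmul_ne {s e : G} {n : ℕ}
    (h : ∀ k, 1 ≤ k → k ≤ n → k • e ≠ 0) : #(apFinset s e (n + 1)) = n + 1 := by
  apply card_apFinset_of_addOrderOf
  rcases Nat.eq_zero_or_pos (addOrderOf e) with h0 | hpos
  · exact Or.inl h0
  · right
    by_contra hlt
    push Not at hlt
    exact h (addOrderOf e) hpos (by omega) (addOrderOf_nsmul_eq_zero e)

/-- The dichotomy behind the printed «since `d⊆(A, AP) ≥ 2` … `x ∉ {2d, 3d, −d, −2d}`»: if `A` lies in a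
progression `P = {s, …, s + (n−1)e}` (`e ≠ 0`, `n ≥ 1`) with `|P ∖ A| ≤ 1`, then either `P` is a genuine
quasi-progression and `d⊆(A, 𝒬𝒜𝒫_e) ≤ 1`, or `P` is a full `⟨e⟩`-coset and `d⊆(A, 𝒬𝒫) ≤ 1`.
[cite: Grynkiewicz2009, §6 Claim 9 (p. 29)] -/
theorem subsetDist_le_one_of_subset_apFinset {A : Finset G} {s e : G} {n : ℕ} (he : e ≠ 0)
    (hn : 1 ≤ n) (hAP : A ⊆ apFinset s e n) (h1 : #(apFinset s e n \ A) ≤ 1) :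
    subsetDist A {P | IsQuasiPeriodic P} ≤ 1 ∨ subsetDist A {P | IsQuasiProgression e P} ≤ 1 := by
  set P := apFinset s e n with hP
  have hPne : P.Nonempty := ⟨s, mem_apFinset.2 ⟨0, by omega, by rw [zero_nsmul, add_zero]⟩⟩
  have h1' : ((#(P \ A) : ℕ) : ℕ∞) ≤ 1 := by exact_mod_cast h1
  by_cases hdist : ∀ k, 1 ≤ k → k ≤ n → k • e ≠ 0
  · right
    have hq : IsQuasiProgression e P := by
      have hc := card_apFinset_succ_of_forall_nsmul_ne (s := s) hdist
      obtain ⟨m, rfl⟩ : ∃ m, n = m + 1 := ⟨n - 1, by omega⟩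
      exact isQuasiProgression_apFinset (by omega) hc
    exact (subsetDist_le (𝒮 := {P | IsQuasiProgression e P}) hq hAP).trans h1'
  · left
    push Not at hdist
    obtain ⟨k, hk1, hkn, hk⟩ := hdist
    have hper : e +ᵥ P = P := vadd_apFinset_eq_of_nsmul_eq_zero hk1 hkn hk
    have hmem : e ∈ P.addStab := (mem_addStab hPne).2 hper
    have hne : P.addStab ≠ {0} := fun h0 => he (by rw [h0, mem_singleton] at hmem; exact hmem)
    have hqp : IsQuasiPeriodic P := ((isPeriodic_iff_addStab_ne hPne).2 hne).isQuasiPeriodic hPne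
    exact (subsetDist_le (𝒮 := {P | IsQuasiPeriodic P}) hqp hAP).trans h1'

/-- The working form: under (47) `2 ≤ d⊆(A, 𝒬𝒫)` and (50) `2 ≤ d⊆(A, 𝒬𝒜𝒫_e)` (`e ≠ 0`), `A` cannot lie in
a progression of difference `e` up to one hole. [cite: Grynkiewicz2009, §6 Claim 9 (p. 29)] -/
theorem false_of_subset_apFinset {A : Finset G} {s e : G} {n : ℕ} (he : e ≠ 0) (hn : 1 ≤ n)
    (hAP : A ⊆ apFinset s e n) (h1 : #(apFinset s e n \ A) ≤ 1)
    (h47 : 2 ≤ subsetDist A {P | IsQuasiPeriodic P})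
    (h50 : ∀ e : G, e ≠ 0 → 2 ≤ subsetDist A {P | IsQuasiProgression e P}) : False := by
  rcases subsetDist_le_one_of_subset_apFinset he hn hAP h1 with h | h
  · exact absurd (h47.trans h) (by norm_num)
  · exact absurd ((h50 e he).trans h) (by norm_num)

/-! ### Cosets of subgroups of order two and three -/

/-- «`A` not quasi-periodic … with `|A| = 3` implies `A` does not contain a coset of an order two
subgroup»: if `A = {u, v, w}` with `u ≠ v` and `2(v − u) = 0`, then `A` is quasi-periodic (periodic part
`{u, v} = u + ⟨v − u⟩`, aperiodic part `{w}`). [cite: Grynkiewicz2009, §6 Claim 9 (p. 29) and Claim 6 (p. 27)] -/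
theorem isQuasiPeriodic_of_pair {A : Finset G} {u v w : G} (hA : A = {u, v, w}) (huv : u ≠ v)
    (h2 : (v - u) + (v - u) = 0) : IsQuasiPeriodic A := by
  set e := v - u with he
  have he0 : e ≠ 0 := fun h => huv (by rw [he, sub_eq_zero] at h; exact h.symm)
  have hPne : ({u, v} : Finset G).Nonempty := insert_nonempty u {v}
  have hper : e +ᵥ ({u, v} : Finset G) = {u, v} := by
    rw [vadd_finset_insert, vadd_finset_singleton, vadd_eq_add, vadd_eq_add]
    have h1 : e + u = v := by rw [he]; abel
    have h2' : e + v = u := by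
      have : e + v = (e + e) + u := by rw [he]; abel
      rw [this, h2, zero_add]
    rw [h1, h2', pair_comm]
  have hmem : e ∈ ({u, v} : Finset G).addStab := (mem_addStab hPne).2 hper
  have hne : ({u, v} : Finset G).addStab ≠ {0} := fun h0 =>
    he0 (by rw [h0, mem_singleton] at hmem; exact hmem)
  obtain ⟨H, hH, hHP⟩ := (isPeriodic_iff_addStab_ne hPne).2 hne
  have hAeq : A = {u, v} ∪ {w} := by
    rw [hA]; ext y; simp only [mem_insert, mem_singleton, mem_union]; tauto
  rw [hAeq]
  exact isQuasiPeriodic_union_of_isPeriodicWith hH hHP hPne fun x hx y hy => by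
    rw [mem_singleton] at hx hy
    rw [hx, hy, sub_self]
    exact H.zero_mem

/-- `3d = 0` (with `d ≠ 0`): `A = {0, d, x}` lies with at most one hole in the quasi-periodic set
`⟨d⟩ ∪ {x} = {0, d, 2d} ∪ {x}`, so `d⊆(A, 𝒬𝒫) ≤ 1` («`3d ≠ 0` … follows from (47)»).
[cite: Grynkiewicz2009, §6 Claim 9 (p. 29)] -/
theorem subsetDist_le_one_of_three_nsmul {A : Finset G} {d x : G} (hA : A = {0, d, x}) (hd : d ≠ 0)
    (h3 : d + d + d = 0) : subsetDist A {P | IsQuasiPeriodic P} ≤ 1 := by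
  set P₁ := apFinset (0 : G) d 3 with hP₁
  have hP₁ne : P₁.Nonempty := ⟨0, mem_apFinset.2 ⟨0, by omega, by rw [zero_nsmul, add_zero]⟩⟩
  have h3' : 3 • d = 0 := by rw [succ_nsmul, two_nsmul, h3]
  have hper : d +ᵥ P₁ = P₁ := vadd_apFinset_eq_of_nsmul_eq_zero (k := 3) (by omega) le_rfl h3'
  have hmem : d ∈ P₁.addStab := (mem_addStab hP₁ne).2 hper
  have hne : P₁.addStab ≠ {0} := fun h0 => hd (by rw [h0, mem_singleton] at hmem; exact hmem)
  obtain ⟨H, hH, hHP⟩ := (isPeriodic_iff_addStab_ne hP₁ne).2 hne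
  have hqp : IsQuasiPeriodic (P₁ ∪ {x}) :=
    isQuasiPeriodic_union_of_isPeriodicWith hH hHP hP₁ne fun a ha b hb => by
      rw [mem_singleton] at ha hb
      rw [ha, hb, sub_self]
      exact H.zero_mem
  have h0P : (0 : G) ∈ P₁ := mem_apFinset.2 ⟨0, by omega, by rw [zero_nsmul, add_zero]⟩
  have hdP : d ∈ P₁ := mem_apFinset.2 ⟨1, by omega, by rw [one_nsmul, zero_add]⟩
  have hAP : A ⊆ P₁ ∪ {x} := by
    rw [hA]
    intro y hy
    simp only [mem_insert, mem_singleton] at hy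
    rcases hy with rfl | rfl | rfl
    · exact mem_union_left _ h0P
    · exact mem_union_left _ hdP
    · exact mem_union_right _ (mem_singleton_self _)
  have h1 : #((P₁ ∪ {x}) \ A) ≤ 1 := by
    refine (card_le_card (fun y hy => ?_)).trans (card_singleton (d + d)).le
    rw [mem_sdiff, mem_union, mem_singleton] at hy
    obtain ⟨hy, hyA⟩ := hy
    rw [mem_singleton]
    rw [hA] at hyA
    simp only [mem_insert, mem_singleton, not_or] at hyA
    rcases hy with hy | hy
    · obtain ⟨i, hi, rfl⟩ := mem_apFinset.1 hy
      interval_cases i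
      · exact absurd (by rw [zero_nsmul, add_zero]) hyA.1
      · exact absurd (by rw [one_nsmul, zero_add]) hyA.2.1
      · rw [two_nsmul, zero_add]
    · exact absurd hy hyA.2.2
  exact (subsetDist_le (𝒮 := {P | IsQuasiPeriodic P}) hqp hAP).trans (by exact_mod_cast h1)

/-! ### The exclusions -/

omit [AddCommGroup G] in
/-- `|P ∖ A| ≤ 1` once every element of `P` is in `A` or equals a fixed `p`. [folklore] -/
private theorem card_sdiff_le_one_of_forall {P A : Finset G} {p : G} (h : ∀ y ∈ P, y ∈ A ∨ y = p) :
    #(P \ A) ≤ 1 := by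
  refine (card_le_card (fun y hy => ?_)).trans (card_singleton p).le
  rw [mem_sdiff] at hy
  rcases h y hy.1 with h' | h'
  · exact absurd h' hy.2
  · rw [mem_singleton]; exact h'

/-- **The exclusions feeding `claim9_terminal`.**  For `A = {0, d, x}` with `|A| = 3`, display (47)
`d⊆(A, 𝒬𝒫) ≥ 2` and display (50) `d⊆(A, 𝒬𝒜𝒫_e) ≥ 2` for all `e ≠ 0`:
`d, x ≠ 0`, `x ≠ d`; no coset of an order-two subgroup inside `A` (`2d, 2x, 2(x − d) ≠ 0`); the
progression exclusions «`x ∉ {2d, 3d, −d, −2d}`», «`d ∉ {2x, …}`» (`d ≠ 2x`), «`0 ∉ {…, 3d − 2x}`»,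
`2x + d ≠ 0`; and `3d ≠ 0`. [cite: Grynkiewicz2009, §6 Claim 9 (pp. 28–29)] -/
theorem claim9_exclusions {A : Finset G} {d x : G} (hA : A = {0, d, x}) (hA3 : #A = 3)
    (h47 : 2 ≤ subsetDist A {P | IsQuasiPeriodic P})
    (h50 : ∀ e : G, e ≠ 0 → 2 ≤ subsetDist A {P | IsQuasiProgression e P}) :
    d ≠ 0 ∧ x ≠ 0 ∧ x ≠ d ∧ d + d ≠ 0 ∧ x + x ≠ 0 ∧ (x - d) + (x - d) ≠ 0 ∧ x ≠ d + d ∧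
      x ≠ d + d + d ∧ x ≠ -d ∧ x ≠ -(d + d) ∧ d ≠ x + x ∧ d + d + d ≠ 0 ∧
      d + d + d - (x + x) ≠ 0 ∧ x + x + d ≠ 0 := by
  -- membership and distinctness
  have h0A : (0 : G) ∈ A := by rw [hA]; simp
  have hdA : d ∈ A := by rw [hA]; simp
  have hxA : x ∈ A := by rw [hA]; simp
  have hmemA : ∀ y, y ∈ A ↔ y = 0 ∨ y = d ∨ y = x := fun y => by
    rw [hA]; simp only [mem_insert, mem_singleton]
  have hd0 : d ≠ 0 := by
    rintro rfl
    rw [hA, insert_eq_of_mem (mem_insert_self (0 : G) {x})] at hA3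
    exact absurd hA3 (by have := card_le_two (a := (0 : G)) (b := x); omega)
  have hx0 : x ≠ 0 := by
    rintro rfl
    rw [hA, pair_comm, insert_eq_of_mem (mem_insert_self (0 : G) {d})] at hA3
    exact absurd hA3 (by have := card_le_two (a := (0 : G)) (b := d); omega)
  have hxd : x ≠ d := by
    rintro rfl
    rw [hA, pair_eq_singleton, ] at hA3
    exact absurd hA3 (by have := card_le_two (a := (0 : G)) (b := x); omega)
  -- `A` is not quasi-periodic (from (47))
  have hAqp : ¬ IsQuasiPeriodic A := fun hqp => by
    have h0 : subsetDist A {P | IsQuasiPeriodic P} = 0 := subsetDist_eq_zero_iff.2 hqp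
    rw [h0] at h47
    exact absurd h47 (by norm_num)
  -- no coset of an order-two subgroup
  have h2d : d + d ≠ 0 := fun h =>
    hAqp (isQuasiPeriodic_of_pair (u := 0) (v := d) (w := x) hA hd0.symm (by rw [sub_zero]; exact h))
  have h2x : x + x ≠ 0 := fun h =>
    hAqp (isQuasiPeriodic_of_pair (u := 0) (v := x) (w := d)
      (by rw [hA]; ext y; simp only [mem_insert, mem_singleton]; tauto) hx0.symm
      (by rw [sub_zero]; exact h))
  have h2xd : (x - d) + (x - d) ≠ 0 := fun h =>
    hAqp (isQuasiPeriodic_of_pair (u := d) (v := x) (w := 0)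
      (by rw [hA]; ext y; simp only [mem_insert, mem_singleton]; tauto) hxd.symm h)
  -- the progression exclusions
  have hAsub : ∀ {P : Finset G}, (0 : G) ∈ P → d ∈ P → x ∈ P → A ⊆ P := by
    intro P h0 hd hx y hy
    rcases (hmemA y).1 hy with rfl | rfl | rfl
    · exact h0
    · exact hd
    · exact hx
  have hx2d : x ≠ d + d := by
    intro h
    refine false_of_subset_apFinset (s := 0) (e := d) (n := 3) hd0 (by omega)
      (hAsub ?_ ?_ ?_) (card_sdiff_le_one_of_forall (p := 0) fun y hy => ?_) h47 h50
    · exact mem_apFinset.2 ⟨0, by omega, by rw [zero_nsmul, add_zero]⟩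
    · exact mem_apFinset.2 ⟨1, by omega, by rw [one_nsmul, zero_add]⟩
    · exact mem_apFinset.2 ⟨2, by omega, by rw [two_nsmul, zero_add, h]⟩
    · obtain ⟨i, hi, rfl⟩ := mem_apFinset.1 hy
      left
      interval_cases i
      · rw [zero_nsmul, add_zero]; exact h0A
      · rw [one_nsmul, zero_add]; exact hdA
      · rw [two_nsmul, zero_add, ← h]; exact hxA
  have hx3d : x ≠ d + d + d := by
    intro h
    refine false_of_subset_apFinset (s := 0) (e := d) (n := 4) hd0 (by omega)
      (hAsub ?_ ?_ ?_) (card_sdiff_le_one_of_forall (p := d + d) fun y hy => ?_) h47 h50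
    · exact mem_apFinset.2 ⟨0, by omega, by rw [zero_nsmul, add_zero]⟩
    · exact mem_apFinset.2 ⟨1, by omega, by rw [one_nsmul, zero_add]⟩
    · exact mem_apFinset.2 ⟨3, by omega, by rw [succ_nsmul, two_nsmul, zero_add, h]⟩
    · obtain ⟨i, hi, rfl⟩ := mem_apFinset.1 hy
      interval_cases i
      · left; rw [zero_nsmul, add_zero]; exact h0A
      · left; rw [one_nsmul, zero_add]; exact hdA
      · right; rw [two_nsmul, zero_add]
      · left; rw [succ_nsmul, two_nsmul, zero_add, ← h]; exact hxA
  have hxnd : x ≠ -d := by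
    intro h
    refine false_of_subset_apFinset (s := -d) (e := d) (n := 3) hd0 (by omega)
      (hAsub ?_ ?_ ?_) (card_sdiff_le_one_of_forall (p := 0) fun y hy => ?_) h47 h50
    · exact mem_apFinset.2 ⟨1, by omega, by rw [one_nsmul, neg_add_cancel]⟩
    · exact mem_apFinset.2 ⟨2, by omega, by rw [two_nsmul]; abel⟩
    · exact mem_apFinset.2 ⟨0, by omega, by rw [zero_nsmul, add_zero, h]⟩
    · obtain ⟨i, hi, rfl⟩ := mem_apFinset.1 hy
      left
      interval_cases i
      · rw [zero_nsmul, add_zero, ← h]; exact hxA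
      · rw [one_nsmul, neg_add_cancel]; exact h0A
      · rw [two_nsmul, show -d + (d + d) = d by abel]; exact hdA
  have hxn2d : x ≠ -(d + d) := by
    intro h
    refine false_of_subset_apFinset (s := -(d + d)) (e := d) (n := 4) hd0 (by omega)
      (hAsub ?_ ?_ ?_) (card_sdiff_le_one_of_forall (p := -d) fun y hy => ?_) h47 h50
    · exact mem_apFinset.2 ⟨2, by omega, by rw [two_nsmul, neg_add_cancel]⟩
    · exact mem_apFinset.2 ⟨3, by omega, by rw [succ_nsmul, two_nsmul]; abel⟩
    · exact mem_apFinset.2 ⟨0, by omega, by rw [zero_nsmul, add_zero, h]⟩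
    · obtain ⟨i, hi, rfl⟩ := mem_apFinset.1 hy
      interval_cases i
      · left; rw [zero_nsmul, add_zero, ← h]; exact hxA
      · right; rw [one_nsmul]; abel
      · left; rw [two_nsmul, neg_add_cancel]; exact h0A
      · left; rw [succ_nsmul, two_nsmul, show -(d + d) + (d + d + d) = d by abel]; exact hdA
  have hd2x : d ≠ x + x := by
    intro h
    refine false_of_subset_apFinset (s := 0) (e := x) (n := 3) hx0 (by omega)
      (hAsub ?_ ?_ ?_) (card_sdiff_le_one_of_forall (p := 0) fun y hy => ?_) h47 h50
    · exact mem_apFinset.2 ⟨0, by omega, by rw [zero_nsmul, add_zero]⟩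
    · exact mem_apFinset.2 ⟨2, by omega, by rw [two_nsmul, zero_add, h]⟩
    · exact mem_apFinset.2 ⟨1, by omega, by rw [one_nsmul, zero_add]⟩
    · obtain ⟨i, hi, rfl⟩ := mem_apFinset.1 hy
      left
      interval_cases i
      · rw [zero_nsmul, add_zero]; exact h0A
      · rw [one_nsmul, zero_add]; exact hxA
      · rw [two_nsmul, zero_add, ← h]; exact hdA
  have h3d : d + d + d ≠ 0 := fun h =>
    absurd (h47.trans (subsetDist_le_one_of_three_nsmul hA hd0 h)) (by norm_num)
  have h3d2x : d + d + d - (x + x) ≠ 0 := by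
    intro h
    -- `e = x − d`: `2e = d`, `3e = x`, so `A = {0, 2e, 3e} ⊆ {0, e, 2e, 3e}`
    have he : x - d ≠ 0 := sub_ne_zero.2 hxd
    have h2e : (x - d) + (x - d) = d := by
      rw [sub_eq_zero] at h
      have : (x - d) + (x - d) = (x + x) - d - d := by abel
      rw [this, ← h]; abel
    refine false_of_subset_apFinset (s := 0) (e := x - d) (n := 4) he (by omega)
      (hAsub ?_ ?_ ?_) (card_sdiff_le_one_of_forall (p := x - d) fun y hy => ?_) h47 h50
    · exact mem_apFinset.2 ⟨0, by omega, by rw [zero_nsmul, add_zero]⟩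
    · exact mem_apFinset.2 ⟨2, by omega, by rw [two_nsmul, zero_add, h2e]⟩
    · exact mem_apFinset.2 ⟨3, by omega, by
        rw [succ_nsmul, two_nsmul, zero_add, h2e, add_comm, sub_add_cancel]⟩
    · obtain ⟨i, hi, rfl⟩ := mem_apFinset.1 hy
      interval_cases i
      · left; rw [zero_nsmul, add_zero]; exact h0A
      · right; rw [one_nsmul, zero_add]
      · left; rw [two_nsmul, zero_add, h2e]; exact hdA
      · left; rw [succ_nsmul, two_nsmul, zero_add, h2e, add_comm, sub_add_cancel]; exact hxA
  have h2xpd : x + x + d ≠ 0 := by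
    intro h
    -- `d = −2x`: `A = {−2x, 0, x} ⊆ {−2x, −x, 0, x}`
    have hd : d = -(x + x) := by rw [← sub_eq_zero, sub_neg_eq_add, add_comm]; exact h
    refine false_of_subset_apFinset (s := -(x + x)) (e := x) (n := 4) hx0 (by omega)
      (hAsub ?_ ?_ ?_) (card_sdiff_le_one_of_forall (p := -x) fun y hy => ?_) h47 h50
    · exact mem_apFinset.2 ⟨2, by omega, by rw [two_nsmul, neg_add_cancel]⟩
    · exact mem_apFinset.2 ⟨0, by omega, by rw [zero_nsmul, add_zero, hd]⟩
    · exact mem_apFinset.2 ⟨3, by omega, by rw [succ_nsmul, two_nsmul]; abel⟩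
    · obtain ⟨i, hi, rfl⟩ := mem_apFinset.1 hy
      interval_cases i
      · left; rw [zero_nsmul, add_zero, ← hd]; exact hdA
      · right; rw [one_nsmul]; abel
      · left; rw [two_nsmul, neg_add_cancel]; exact h0A
      · left; rw [succ_nsmul, two_nsmul, show -(x + x) + (x + x + x) = x by abel]; exact hxA
  exact ⟨hd0, hx0, hxd, h2d, h2x, h2xd, hx2d, hx3d, hxnd, hxn2d, hd2x, h3d, h3d2x, h2xpd⟩

end Literature.Combinatorics.Additive.Grynkiewicz2009
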